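import Summits.AnomalousDissipation.AnomalousDissipation.Theses.EnsembleRigidity
import Summits.AnomalousDissipation.AnomalousDissipation.Theorems.EnsembleRigidityDefs
import Summits.AnomalousDissipation.AnomalousDissipation.Theorems.TaylorCertificatesSteadyStatesLoudBoundedStubGpAdmissible
import Summits.AnomalousDissipation.AnomalousDissipation.Theorems.EnsembleRigidityGPStatisticalRigidityLinearTestLimit
import Summits.AnomalousDissipation.AnomalousDissipation.Theorems.EnsembleRigidityGPStatisticalRigidityGpSmallEnergy
import Summits.AnomalousDissipation.AnomalousDissipation.Theorems.EnsembleRigidityGPStatisticalRigidityDesaturation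
import HarnessLib

/-!
# Crux `EnsembleRigidity.GPStatisticalRigidity` (stmt-AnomalousDissipation-15508), line `Sketch` —
# the two CLOSED consequences of the landed stubs

1. **The crux holds below the second-moment horizon** (`gpRigid_smallEnergy`). For every level
   `E < 3/(4π)` the conclusion block of `GPStatisticalRigidity` holds with `c = 1` and
   `δ₀ = (3/2 − 2πE)/(2π√6)`, vacuously: a probability measure `μ` on `H` with integrable energy `≤ E`
   and cylindrical forced-Euler defect `≤ R ≤ δ₀` would satisfy the fixed-test balance at `w = f_GP`
   (cut-off removal, `stub_linearTestLimit`) and hence `(3/2 − 2πE)/(π√6) ≤ R` (second-moment test,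
   `stub_gpSmallEnergy`), i.e. `2δ₀ ≤ R ≤ δ₀`, absurd. (Doering–Foias: no statistics of mean energy
   below `‖f‖₂²/‖sym∇f‖_∞` nearly balances `f`.)
2. **The shell-work clause of the crux is idle** (`gpStatisticalRigidity_noShell`): the crux implies the
   same statement with the hypothesis "non-negative work on every energy shell" deleted (time-reversal
   normal form, `stub_desaturation`); the converse is trivial.

The file closes with the registered tools stub `stub_gpPartialTools` (conjunction of 1 and 2).
-/

-- `Summit.<Summit>.<Problem>` is the tree's mandated summit-side namespace (CONVENTIONS §2); single-conjunct summit, duplicate deliberate.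
set_option linter.dupNamespace false

noncomputable section

namespace Summit.AnomalousDissipation.AnomalousDissipation.Theorems.EnsembleRigidity.GPStatisticalRigidity

open MeasureTheory Filter Topology UnitAddTorus
open scoped InnerProductSpace RealInnerProductSpace ENNReal NNReal
open Literature.Analysis.FunctionSpaces Literature.Analysis.FluidPDE
open Summit.AnomalousDissipation.AnomalousDissipation.Theorems.EnsembleRigidity

/-- Local notation: real vector fields on `T³`. -/
local notation "Vec3" => (UnitAddTorus (Fin 3)) → (EuclideanSpace ℝ (Fin 3))
/-- Local notation: `L²(T³; ℝ³)`. -/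
local notation "L2" => (Lp (EuclideanSpace ℝ (Fin 3)) 2 (volume : Measure (UnitAddTorus (Fin 3))))
/-- Local notation: the energy space `H`. -/
local notation "H3" => (Torus.energySpace (Fin 3))

/-- `f_GP` is smooth, divergence free and mean zero (landed `stub_gpAdmissible`). [folklore] -/
theorem gpForce_admissible :
    Torus.IsSmooth gpForce ∧ Torus.IsDivFree gpForce ∧ Torus.HasZeroMean gpForce :=
  SteadyStatesLoudBounded.GpAdmissible.stub_gpAdmissible

/-- **Rigidity below the second-moment horizon.** For `E < 3/(4π)` the conclusion block of the crux
`GPStatisticalRigidity` holds at level `E` (even without the shell-work hypothesis) with `c = 1` and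
`δ₀ = (3/2 − 2πE)/(2π√6)`: an admissible `μ` with defect `R ≤ δ₀` would have, by the cut-off removal
at `w = f_GP` and the second-moment test, `2δ₀ ≤ R ≤ δ₀`, absurd. [folklore] -/
theorem gpRigid_smallEnergy (f : Vec3) (hf : f = gpForce) (E : ℝ) (hE : E < 3 / (4 * Real.pi)) :
    ∃ c δ₀ : ℝ, 0 < c ∧ 0 < δ₀ ∧ ∀ μ : Measure H3, IsProbabilityMeasure μ →
      Integrable (fun v : H3 => ‖v‖ ^ 2) μ → Torus.ensembleEnergy μ ≤ E → Torus.ensembleEnstrophy μ < ⊤ →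
      ∀ R : ℝ, 0 ≤ R → R ≤ δ₀ →
        (∀ Φ : Torus.CylindricalTest (Fin 3),
          Integrable (fun v : H3 => Torus.nsGeneratorPairing 0 f v (Φ.grad v)) μ ∧
            |∫ v, Torus.nsGeneratorPairing 0 f v (Φ.grad v) ∂μ| ≤
              R * Real.sqrt (∫ v, Torus.gradNormSq (Φ.grad v) ∂μ)) →
        c ≤ R * Real.sqrt (Torus.ensembleEnstrophy μ).toReal := by
  have hpi : 0 < Real.pi := Real.pi_pos
  have hnum : 0 < 3 / 2 - 2 * Real.pi * E := by
    have h1 : 2 * Real.pi * E < 2 * Real.pi * (3 / (4 * Real.pi)) :=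
      mul_lt_mul_of_pos_left hE (by positivity)
    have h2 : 2 * Real.pi * (3 / (4 * Real.pi)) = 3 / 2 := by
      field_simp
      ring
    linarith
  set δ₀ : ℝ := (3 / 2 - 2 * Real.pi * E) / (Real.pi * Real.sqrt 6) / 2 with hδ₀
  have hδ₀pos : 0 < δ₀ := by positivity
  refine ⟨1, δ₀, one_pos, hδ₀pos, ?_⟩
  intro μ hμ hint hEμ _hG R _hR0 hRδ hdef
  exfalso
  obtain ⟨hsm, hdf, hzm⟩ := gpForce_admissible
  have hf2 : MemLp f 2 volume := by rw [hf]; exact hsm.memLp 2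
  have hL := stub_linearTestLimit f f hf2 (hf ▸ hsm) (hf ▸ hdf) (hf ▸ hzm) μ hμ hint R hdef
  have hS := stub_gpSmallEnergy f hf E μ hμ hint hEμ R hL.2
  have : 2 * δ₀ = (3 / 2 - 2 * Real.pi * E) / (Real.pi * Real.sqrt 6) := by rw [hδ₀]; ring
  linarith

/-- **The crux below the horizon, verbatim shape.** `GPStatisticalRigidity` restricted to levels
`E < 3/(4π)` (the shell-work hypothesis is accepted and discarded). [folklore] -/
theorem gpStatisticalRigidity_smallEnergy (f : Vec3)
    (hf : f = (fun x : UnitAddTorus (Fin 3) =>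
      (Literature.Analysis.FluidPDE.Torus.stokesMode (Pi.single (2 : Fin 3) (1 : ℤ))
          (EuclideanSpace.single (0 : Fin 3) (1 : ℝ)) false x +
        Literature.Analysis.FluidPDE.Torus.stokesMode (Pi.single (0 : Fin 3) (1 : ℤ))
          (EuclideanSpace.single (1 : Fin 3) (1 : ℝ)) false x +
        Literature.Analysis.FluidPDE.Torus.stokesMode (Pi.single (1 : Fin 3) (1 : ℤ))
          (EuclideanSpace.single (2 : Fin 3) (1 : ℝ)) false x : EuclideanSpace ℝ (Fin 3))))
    (E : ℝ) (hE : E < 3 / (4 * Real.pi)) :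
    ∃ c δ₀ : ℝ, 0 < c ∧ 0 < δ₀ ∧ ∀ μ : Measure H3, IsProbabilityMeasure μ →
      Integrable (fun v : H3 => ‖v‖ ^ 2) μ → Torus.ensembleEnergy μ ≤ E → Torus.ensembleEnstrophy μ < ⊤ →
      (∀ e₁ e₂ : ℝ≥0∞, e₁ < e₂ →
        0 ≤ ∫ v in {v : H3 | e₁ ≤ ‖v‖ₑ ^ 2 ∧ ‖v‖ₑ ^ 2 < e₂}, Torus.pairing (v : L2) f ∂μ) →
      ∀ R : ℝ, 0 ≤ R → R ≤ δ₀ →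
        (∀ Φ : Torus.CylindricalTest (Fin 3),
          Integrable (fun v : H3 => Torus.nsGeneratorPairing 0 f v (Φ.grad v)) μ ∧
            |∫ v, Torus.nsGeneratorPairing 0 f v (Φ.grad v) ∂μ| ≤
              R * Real.sqrt (∫ v, Torus.gradNormSq (Φ.grad v) ∂μ)) →
        c ≤ R * Real.sqrt (Torus.ensembleEnstrophy μ).toReal := by
  obtain ⟨c, δ₀, hc, hδ₀, hrig⟩ := gpRigid_smallEnergy f (hf.trans gpForce_eq.symm) E hE
  exact ⟨c, δ₀, hc, hδ₀, fun μ hμ hint hEμ hG _hshell R hR0 hRδ hdef =>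
    hrig μ hμ hint hEμ hG R hR0 hRδ hdef⟩

/-- **Desaturated form of the crux** (normal form): `GPStatisticalRigidity` implies the same statement
with the shell-work hypothesis deleted (`stub_desaturation`); the converse is trivial. [folklore] -/
theorem gpStatisticalRigidity_noShell
    (h : Summit.AnomalousDissipation.AnomalousDissipation.Theses.EnsembleRigidity.GPStatisticalRigidity)
    (f : Vec3) (hf : f = gpForce) (E : ℝ) :
    ∃ c δ₀ : ℝ, 0 < c ∧ 0 < δ₀ ∧ ∀ μ : Measure H3, IsProbabilityMeasure μ →
      Integrable (fun v : H3 => ‖v‖ ^ 2) μ → Torus.ensembleEnergy μ ≤ E → Torus.ensembleEnstrophy μ < ⊤ →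
      ∀ R : ℝ, 0 ≤ R → R ≤ δ₀ →
        (∀ Φ : Torus.CylindricalTest (Fin 3),
          Integrable (fun v : H3 => Torus.nsGeneratorPairing 0 f v (Φ.grad v)) μ ∧
            |∫ v, Torus.nsGeneratorPairing 0 f v (Φ.grad v) ∂μ| ≤
              R * Real.sqrt (∫ v, Torus.gradNormSq (Φ.grad v) ∂μ)) →
        c ≤ R * Real.sqrt (Torus.ensembleEnstrophy μ).toReal := by
  obtain ⟨c, δ₀, hc, hδ₀, hrig⟩ := h f (hf.trans gpForce_eq) E
  have hf2 : MemLp f 2 volume := by rw [hf]; exact gpForce_admissible.1.memLp 2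
  exact ⟨c, δ₀, hc, hδ₀, stub_desaturation f hf2 E c δ₀ hrig⟩

/-- **Tools stub `stub_gpPartialTools`** (registered on stmt-AnomalousDissipation-15508): the two closed
consequences of line `Sketch` after cycle 1 — (1) the crux's conclusion at every level `E < 3/(4π)`;
(2) the crux implies its shell-free form. [folklore] -/
theorem stub_gpPartialTools :
    (∀ f : Vec3, f = gpForce → ∀ E : ℝ, E < 3 / (4 * Real.pi) →
      ∃ c δ₀ : ℝ, 0 < c ∧ 0 < δ₀ ∧ ∀ μ : Measure H3, IsProbabilityMeasure μ →
        Integrable (fun v : H3 => ‖v‖ ^ 2) μ → Torus.ensembleEnergy μ ≤ E → Torus.ensembleEnstrophy μ < ⊤ →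
        ∀ R : ℝ, 0 ≤ R → R ≤ δ₀ →
          (∀ Φ : Torus.CylindricalTest (Fin 3),
            Integrable (fun v : H3 => Torus.nsGeneratorPairing 0 f v (Φ.grad v)) μ ∧
              |∫ v, Torus.nsGeneratorPairing 0 f v (Φ.grad v) ∂μ| ≤
                R * Real.sqrt (∫ v, Torus.gradNormSq (Φ.grad v) ∂μ)) →
          c ≤ R * Real.sqrt (Torus.ensembleEnstrophy μ).toReal) ∧
    (Summit.AnomalousDissipation.AnomalousDissipation.Theses.EnsembleRigidity.GPStatisticalRigidity →
      ∀ f : Vec3, f = gpForce → ∀ E : ℝ,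
      ∃ c δ₀ : ℝ, 0 < c ∧ 0 < δ₀ ∧ ∀ μ : Measure H3, IsProbabilityMeasure μ →
        Integrable (fun v : H3 => ‖v‖ ^ 2) μ → Torus.ensembleEnergy μ ≤ E → Torus.ensembleEnstrophy μ < ⊤ →
        ∀ R : ℝ, 0 ≤ R → R ≤ δ₀ →
          (∀ Φ : Torus.CylindricalTest (Fin 3),
            Integrable (fun v : H3 => Torus.nsGeneratorPairing 0 f v (Φ.grad v)) μ ∧
              |∫ v, Torus.nsGeneratorPairing 0 f v (Φ.grad v) ∂μ| ≤
                R * Real.sqrt (∫ v, Torus.gradNormSq (Φ.grad v) ∂μ)) →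
          c ≤ R * Real.sqrt (Torus.ensembleEnstrophy μ).toReal) :=
  ⟨gpRigid_smallEnergy, gpStatisticalRigidity_noShell⟩

end Summit.AnomalousDissipation.AnomalousDissipation.Theorems.EnsembleRigidity.GPStatisticalRigidity

end
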